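import Summits.BirchSwinnertonDyer.BirchSwinnertonDyer.Theorems.ByReductionTypeAtTwoRankOneAtTwoOneDoorLawBottomDefs
import Summits.BirchSwinnertonDyer.BirchSwinnertonDyer.Theorems.ByReductionTypeAtTwoRankOneAtTwoBigImageOddLocalOneDoorPairParity
import Summits.BirchSwinnertonDyer.BirchSwinnertonDyer.Theorems.ByReductionTypeAtTwoRankOneAtTwoBigImageOddLocalOneDoorHalvesBookkeeping
import Summits.BirchSwinnertonDyer.BirchSwinnertonDyer.Theorems.ByReductionTypeAtTwoRankOneAtTwoBigImageOddLocalOneDoorAnalyticPrimary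
import Literature.NumberTheory.EllipticCurves.SecondDescentShaExponentProofs
import Summits.BirchSwinnertonDyer.Uniform.U2.TransportA
import HarnessLib

/-!
# Route ByReductionTypeAtTwo, crux `RankOneAtTwoBigImageOddLocal` (stmt-BirchSwinnertonDyer-23715), LINE v8.7/v8.8 `one_door_analytic`:
# the `2`-SELMER END-GAME of the bottom rung — `DoorIndexLawUpperCAtTwoBottom(Neg)` from `#Sel₂(W) ≤ 2 ∧ #Sel₂(Wd) ≤ 1`

Width prover seat `bsd-line-fkl-p2` g10 (2026-08-28), `--supports stmt-BirchSwinnertonDyer-23715` (helper).  THEOREMS ONLY; no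
definition, no named fact introduced, no `sorry`; BSD is not proved by any of this.

The lead's kernel engine of Kolyvagin's first `2`-descent over `ℚ` at a minimal door (`Theorems/…OneDoorFirstDescentAtTwo.lean`,
p637958) concludes in `2`-SELMER currency inside `H¹(ℚ, E[2])`: `Nat.card Sel = 2` (`card_sel_eq_two`: `Sel₂(E/ℚ) = {0, δ(T·y_K)}`)
and `Sel' = ⊥` (`twinSel_eq_bot`: `Sel₂(E^K/ℚ) = 0`).  The registered bottom-rung stubs of the skeleton (`stub_doorUpperBottomNeg :
S_pub4 → DoorIndexLawUpperCAtTwoBottomNeg`, v8.7; sign-free `DoorIndexLawUpperCAtTwoBottom`, `…OneDoorLawBottomDefs.lean` APPEND #8)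
conclude in DOOR currency: `ord₂ #Ш(W)[2^∞] + ord₂ #Ш(Wd)[2^∞] + t + 2s + 2·v₂(c) ≤ 2·0 + [Δ_W < 0]`.  This file is the glue
between the two currencies, so that what remains of the bottom rung is EXACTLY the instantiation of the engine's hypotheses:

* §1 `primaryComponent_eq_bot_of_torsionBy_eq_bot` — fact-free group theory: `A[p] = ⊥ ⟹ A[p^∞] = ⊥` (no finiteness);
* §2 `primaryComponent_sha_two_eq_bot_of_card_selmerGroup_le` — for an elliptic curve over `ℚ` with `rank E(ℚ) = r`, no rational
  `2`-torsion and `#Sel₂(E/ℚ) ≤ 2^r`: `Ш(E/ℚ)[2^∞] = ⊥` (the exact descent count `2^{rk}·#E(ℚ)[2]·#Ш[2] = #Sel₂`,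
  `pow_mordellWeilRank_mul_natCard_torsionBy_mul_natCard_shaTorsionBy_eq`, Silverman X.4.2, PROVED in the tree; then §1);
* §3 `bottom_inequality_of_card_selmerGroup_le_at` — at a door datum of the slice with a MINIMAL door (`t + 2s = [Δ_W < 0]`) and an odd
  constant: `#Sel₂(W/ℚ) ≤ 2 ∧ #Sel₂(Wd/ℚ) ≤ 1 ⟹` the bottom-rung inequality, modulo Gross–Zagier / Kolyvagin at `(N_W, W, K)` and
  modularity (for `rank Wd(ℚ) = 0`: `rank E(K) = 1 = rank W(ℚ) + rank Wd(ℚ)`, `exists_unique_exponent_at_door`, `mordellWeilRank_twin_eq_zero`)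
  and `rank W(ℚ) = 1` (binder `hrQ`); the exponent hypothesis `HasTwoDivisibilityUpToTorsion W K P 0` is NOT needed at this stage —
  it is consumed upstream, by the engine (`y = δ(T·y_K) ≠ 0`);
* §4 `doorIndexLawUpperCAtTwoBottom_of_selmerTwo` / `doorIndexLawUpperCAtTwoBottomNeg_of_selmerTwo` — the two tree statements from the
  four PRIMARY printed facts of `S_pub4` (`gross_zagier`, `kolyvagin`, `exists_isNewformOf`, `HoffsteinLuo1997_exists_twist_L_one_ne_zero`;
  `rank W(ℚ) = 1` by `mordellWeilRank_eq_one_of_analyticRank_eq_one_of_isGloballyMinimal`) and ONE ∀-statement in `2`-Selmer currency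
  with the stub's binders VERBATIM (conclusion `Nat.card (W.selmerGroup 2) ≤ 2 ∧ Nat.card (Wd.selmerGroup 2) ≤ 1`) — i.e. the
  bottom-rung stub, granted `S_pub4`, IS its `2`-Selmer form.

References: [SilvermanAEC2009] Thm. X.4.2; [GrossLMS1991] Prop. 2.3, (2.2) and §10; [Kolyvagin1990] Thm. A.
-/

set_option autoImplicit false
-- the Theorems namespace of this sub repeats the summit name by design (D-0017 nested layout)
set_option linter.dupNamespace false

noncomputable section

open scoped Classical AddSubgroup

namespace Summit.BirchSwinnertonDyer.BirchSwinnertonDyer.Theorems.RankOneAtTwoOneDoor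

open WeierstrassCurve NumberField Literature.NumberTheory.EllipticCurves Literature.NumberTheory.EllipticCurves.ModularForms
  Summit.BirchSwinnertonDyer.Rank1Residual
  Summit.BirchSwinnertonDyer.Rank1Residual.F1Sign2
  Summit.BirchSwinnertonDyer.Rank1Residual.F1Sign2.TranspositionDoor
  Summit.BirchSwinnertonDyer.BirchSwinnertonDyer.Theses.ByReductionTypeAtTwo

/-! ### §1 Group theory: no `p`-torsion ⟹ no `p`-primary torsion -/

/-- **`A[p] = ⊥ ⟹ A[p^∞] = ⊥`** for any additive commutative group and any `p : ℕ` (no finiteness): if `p^n • x = 0` with `n ≥ 1`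
then `p^{n-1} • x ∈ A[p] = ⊥`, and induction.  At instantiation: `Ш(E/ℚ)[2] = 0 ⟹ Ш(E/ℚ)[2^∞] = 0`. [folklore] -/
theorem primaryComponent_eq_bot_of_torsionBy_eq_bot {A : Type*} [AddCommGroup A] (p : ℕ) (h : A[(p : ℤ)] = ⊥) :
    AddCommGroup.primaryComponent A p = ⊥ := by
  rw [eq_bot_iff]
  intro x hx
  obtain ⟨n, hn⟩ := (AddCommGroup.mem_primaryComponent).mp hx
  clear hx
  rw [AddSubgroup.mem_bot]
  induction n generalizing x with
  | zero => simpa using hn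
  | succ n ih =>
    have hpx : p ^ n • x ∈ A[(p : ℤ)] := by
      rw [AddSubgroup.torsionBy.nsmul_iff, ← mul_smul, ← pow_succ', hn]
    rw [h, AddSubgroup.mem_bot] at hpx
    exact ih hpx

/-! ### §2 The descent count: `#Sel₂(E/ℚ) ≤ 2^{rk}` and no rational `2`-torsion force `Ш(E/ℚ)[2^∞] = 0` -/

/-- **`rank E(ℚ) = r`, `E(ℚ)[2] = 0`, `#Sel₂(E/ℚ) ≤ 2^r ⟹ Ш(E/ℚ)[2] = ⊥`.**  The exact descent count
`2^{rk}·#E(ℚ)[2]·#Ш(E/ℚ)[2] = #Sel₂(E/ℚ)` (Silverman X.4.2, tree theorem `pow_mordellWeilRank_mul_natCard_torsionBy_mul_natCard_shaTorsionBy_eq`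
over the PROVED Kummer sequence and finiteness of `Sel₂`) reads `2^r · #Ш[2] = #Sel₂ ≤ 2^r` with `#Sel₂ ≠ 0`, so `#Ш[2] = 1`.
[cite: SilvermanAEC2009, Thm. X.4.2] -/
theorem shaTorsionBy_two_eq_bot_of_card_selmerGroup_le (W : WeierstrassCurve ℚ) [W.IsElliptic] {r : ℕ}
    (hrk : W.mordellWeilRank = r) (h2 : ∀ T : W.toAffine.Point, 2 • T = 0 → T = 0)
    (hsel : Nat.card (W.selmerGroup 2) ≤ 2 ^ r) : W.sha[(2 : ℤ)] = ⊥ := by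
  have hbot : W.toAffine.Point[(2 : ℤ)] = ⊥ := Summit.BirchSwinnertonDyer.Uniform.U2.torsionBy_two_eq_bot_iff.mpr h2
  have hpt : Nat.card ↥(W.toAffine.Point[(2 : ℤ)]) = 1 := by rw [hbot]; exact AddSubgroup.card_bot
  have hcount := W.pow_mordellWeilRank_mul_natCard_torsionBy_mul_natCard_shaTorsionBy_eq (n := 2) two_ne_zero
  simp only [Nat.cast_ofNat] at hcount
  rw [hrk] at hcount
  -- bridge the point-group instances (the `DecidableEq` on `E(ℚ)` is a subsingleton)
  have hcount' : 2 ^ r * Nat.card (W.sha[(2 : ℤ)]) = Nat.card (W.selmerGroup 2) := by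
    have h1 : 2 ^ r * 1 * Nat.card (W.sha[(2 : ℤ)]) = Nat.card (W.selmerGroup 2) := by
      convert hcount using 3
      convert hpt.symm using 10
    simpa using h1
  haveI : Finite (W.selmerGroup 2) := W.finite_selmerGroup_holds (by norm_num)
  have hpos : 0 < Nat.card (W.selmerGroup 2) := Nat.card_pos
  have hsha1 : Nat.card (W.sha[(2 : ℤ)]) = 1 := by
    have hle : 2 ^ r * Nat.card (W.sha[(2 : ℤ)]) ≤ 2 ^ r * 1 := by rw [hcount', mul_one]; exact hsel
    have hle' : Nat.card (W.sha[(2 : ℤ)]) ≤ 1 := Nat.le_of_mul_le_mul_left hle (by positivity)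
    have hne : Nat.card (W.sha[(2 : ℤ)]) ≠ 0 := fun h0 => by rw [h0, mul_zero] at hcount'; omega
    omega
  exact AddSubgroup.card_eq_one.mp hsha1

/-- **`rank E(ℚ) = r`, `E(ℚ)[2] = 0`, `#Sel₂(E/ℚ) ≤ 2^r ⟹ Ш(E/ℚ)[2^∞] = ⊥`** (§2 with §1). [cite: SilvermanAEC2009, Thm. X.4.2] -/
theorem primaryComponent_sha_two_eq_bot_of_card_selmerGroup_le (W : WeierstrassCurve ℚ) [W.IsElliptic] {r : ℕ}
    (hrk : W.mordellWeilRank = r) (h2 : ∀ T : W.toAffine.Point, 2 • T = 0 → T = 0)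
    (hsel : Nat.card (W.selmerGroup 2) ≤ 2 ^ r) : AddCommGroup.primaryComponent W.sha 2 = ⊥ :=
  primaryComponent_eq_bot_of_torsionBy_eq_bot 2 (shaTorsionBy_two_eq_bot_of_card_selmerGroup_le W hrk h2 hsel)

/-- The same in the door's currency: `ord₂ #Ш(E/ℚ)[2^∞] = 0`. [cite: SilvermanAEC2009, Thm. X.4.2] -/
theorem padicValNat_card_primaryComponent_sha_two_eq_zero_of_card_selmerGroup_le (W : WeierstrassCurve ℚ) [W.IsElliptic] {r : ℕ}
    (hrk : W.mordellWeilRank = r) (h2 : ∀ T : W.toAffine.Point, 2 • T = 0 → T = 0)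
    (hsel : Nat.card (W.selmerGroup 2) ≤ 2 ^ r) :
    padicValNat 2 (Nat.card (AddCommGroup.primaryComponent W.sha 2)) = 0 := by
  rw [primaryComponent_sha_two_eq_bot_of_card_selmerGroup_le W hrk h2 hsel, AddSubgroup.card_bot]
  simp

/-! ### §3 The bottom rung at a door datum from the two `2`-Selmer counts -/

/-- **No rational `2`-torsion on the twin**: `E(ℚ)[2] = 0` (odd torsion order) transports to any model `Wd` of `E^{(d)}`, `d ≠ 0`
(`x`-coordinates of `2`-torsion points are the roots of the same cubic up to scaling). [folklore] -/
theorem twin_two_torsion_eq_zero (W : WeierstrassCurve ℚ) [W.IsElliptic] (hT : Odd W.torsionOrder) {d : ℚ} (hd : d ≠ 0)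
    (Wd : WeierstrassCurve ℚ) [Wd.IsElliptic] (Cd : VariableChange ℚ) (hWd : Cd • W.quadraticTwist d = Wd) :
    ∀ T : Wd.toAffine.Point, 2 • T = 0 → T = 0 := by
  have hW2 : ∀ T : W.toAffine.Point, 2 • T = 0 → T = 0 :=
    EggDoubling.eq_zero_of_two_smul_eq_zero W (noRationalTwoTorsion_of_odd_torsionOrder W hT)
  have hbotW : W.toAffine.Point[(2 : ℤ)] = ⊥ := Summit.BirchSwinnertonDyer.Uniform.U2.torsionBy_two_eq_bot_iff.mpr hW2
  have hbotWd := Summit.BirchSwinnertonDyer.Uniform.U2.torsionBy_two_eq_bot_of_twist W hd Wd ⟨Cd⁻¹, by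
    rw [← hWd, inv_smul_smul]⟩ hbotW
  exact Summit.BirchSwinnertonDyer.Uniform.U2.torsionBy_two_eq_bot_iff.mp hbotWd

/-- **THE BOTTOM RUNG AT A DOOR DATUM FROM `2`-SELMER COUNTS.**  `W/ℚ` globally minimal with odd torsion order, analytic rank `1` and
`rank W(ℚ) = 1` (`hrQ`); `K` imaginary quadratic with `d_K` door-admissible and `L(W^{(d_K)},1) ≠ 0`; Gross–Zagier and Kolyvagin at
`(N_W, W, K)` and modularity as a newform (`hnf`) — used ONLY for `rank Wd(ℚ) = 0` (`rank E(K) = 1`); ANY datum `Dt`, `H`, `ι`, the point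
`P ∈ E(K)` over the complex Heegner point; `Wd` a globally minimal model of the twist; the door MINIMAL (`t + 2s = [Δ_W < 0]`) and `Dt.c`
odd.  THEN the two `2`-Selmer counts `#Sel₂(W/ℚ) ≤ 2` and `#Sel₂(Wd/ℚ) ≤ 1` — the OUTPUT of Kolyvagin's first `2`-descent over `ℚ`
(`card_sel_eq_two`, `twinSel_eq_bot` of `…OneDoorFirstDescentAtTwo.lean`, once instantiated) — give the bottom-rung inequality
`ord₂ #Ш(W)[2^∞] + ord₂ #Ш(Wd)[2^∞] + t + 2s + 2·v₂(c) ≤ 2·0 + [Δ_W < 0]` (indeed both `2`-primary parts vanish).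
[cite: GrossLMS1991, Prop. 2.3 and (2.2)] [cite: SilvermanAEC2009, Thm. X.4.2] -/
theorem bottom_inequality_of_card_selmerGroup_le_at (hnf : exists_isNewformOf)
    (W : WeierstrassCurve ℚ) [W.IsElliptic] [W.IsGloballyMinimal] [NeZero (W.conductorNorm ℤ)]
    (hT : Odd W.torsionOrder) (hr : W.analyticRank = 1) (hrQ : W.mordellWeilRank = 1)
    (K : Type) [Field K] [NumberField K] (hK : IsImaginaryQuadratic K)
    (hGZ : gross_zagier (W.conductorNorm ℤ) W K) (hKo : kolyvagin (W.conductorNorm ℤ) W K)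
    (hadm : DoorAdmissible W (NumberField.discr K))
    (hLt : (W.quadraticTwist (NumberField.discr K : ℚ)).entireLFunction 1 ≠ 0)
    (Dt : ModularParametrizationData W (W.conductorNorm ℤ))
    (H : HeegnerDatum (W.conductorNorm ℤ) (NumberField.discr K)) (ι : K →+* ℂ)
    (P : (W.baseChange K).toAffine.Point)
    (hP : WeierstrassCurve.Affine.Point.map ι.toRatAlgHom P = heegnerPointComplex Dt H)
    (Wd : WeierstrassCurve ℚ) [Wd.IsElliptic] [Wd.IsGloballyMinimal] (Cd : VariableChange ℚ)
    (hWd : Cd • W.quadraticTwist (NumberField.discr K : ℚ) = Wd)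
    (hmin : transpCount W (NumberField.discr K) + 2 * identCount W (NumberField.discr K) = (if W.Δ < 0 then 1 else 0))
    (hodd : Odd Dt.c)
    (hSelW : Nat.card (W.selmerGroup 2) ≤ 2) (hSelD : Nat.card (Wd.selmerGroup 2) ≤ 1) :
    padicValNat 2 (Nat.card (AddCommGroup.primaryComponent W.sha 2)) +
        padicValNat 2 (Nat.card (AddCommGroup.primaryComponent Wd.sha 2)) +
        transpCount W (NumberField.discr K) + 2 * identCount W (NumberField.discr K) + 2 * padicValInt 2 Dt.c ≤
      2 * 0 + (if W.Δ < 0 then 1 else 0) := by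
  have hmod : hasEntireLFunction_rat := hasEntireLFunction_rat_of_exists_isNewformOf hnf
  have h2K : Module.finrank ℚ K = 2 := hK.1
  have hD0 : (NumberField.discr K : ℚ) ≠ 0 := by exact_mod_cast NumberField.discr_ne_zero K
  -- `rank E(K) = 1` (Gross–Zagier + Kolyvagin at this `K`), hence `rank Wd(ℚ) = 0`
  obtain ⟨hrkK, -, -, -⟩ := exists_unique_exponent_at_door hmod W hr K hK hGZ hKo hadm hLt Dt H ι P hP
  have hrkd : Wd.mordellWeilRank = 0 := mordellWeilRank_twin_eq_zero W K h2K hrkK hrQ Wd Cd hWd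
  -- no rational `2`-torsion on either side
  have hW2 : ∀ T : W.toAffine.Point, 2 • T = 0 → T = 0 :=
    EggDoubling.eq_zero_of_two_smul_eq_zero W (noRationalTwoTorsion_of_odd_torsionOrder W hT)
  have hWd2 : ∀ T : Wd.toAffine.Point, 2 • T = 0 → T = 0 := twin_two_torsion_eq_zero W hT hD0 Wd Cd hWd
  -- both `2`-primary parts vanish
  have hsW : padicValNat 2 (Nat.card (AddCommGroup.primaryComponent W.sha 2)) = 0 :=
    padicValNat_card_primaryComponent_sha_two_eq_zero_of_card_selmerGroup_le W hrQ hW2 (by simpa using hSelW)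
  have hsD : padicValNat 2 (Nat.card (AddCommGroup.primaryComponent Wd.sha 2)) = 0 :=
    padicValNat_card_primaryComponent_sha_two_eq_zero_of_card_selmerGroup_le Wd hrkd hWd2 (by simpa using hSelD)
  exact (bottom_conclusion_iff W (NumberField.discr K) Dt.c _ _ hmin hodd).mpr ⟨hsW, hsD⟩

/-- **The same at NEGATIVE discriminant** (minimal door = `t = 1 ∧ s = 0`), i.e. the conclusion of `DoorIndexLawUpperCAtTwoBottomNeg` at a
datum from the two `2`-Selmer counts. [cite: GrossLMS1991, Prop. 2.3 and (2.2)] -/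
theorem bottomNeg_inequality_of_card_selmerGroup_le_at (hnf : exists_isNewformOf)
    (W : WeierstrassCurve ℚ) [W.IsElliptic] [W.IsGloballyMinimal] [NeZero (W.conductorNorm ℤ)]
    (hT : Odd W.torsionOrder) (hr : W.analyticRank = 1) (hrQ : W.mordellWeilRank = 1)
    (K : Type) [Field K] [NumberField K] (hK : IsImaginaryQuadratic K)
    (hGZ : gross_zagier (W.conductorNorm ℤ) W K) (hKo : kolyvagin (W.conductorNorm ℤ) W K)
    (hadm : DoorAdmissible W (NumberField.discr K))
    (hLt : (W.quadraticTwist (NumberField.discr K : ℚ)).entireLFunction 1 ≠ 0)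
    (Dt : ModularParametrizationData W (W.conductorNorm ℤ))
    (H : HeegnerDatum (W.conductorNorm ℤ) (NumberField.discr K)) (ι : K →+* ℂ)
    (P : (W.baseChange K).toAffine.Point)
    (hP : WeierstrassCurve.Affine.Point.map ι.toRatAlgHom P = heegnerPointComplex Dt H)
    (Wd : WeierstrassCurve ℚ) [Wd.IsElliptic] [Wd.IsGloballyMinimal] (Cd : VariableChange ℚ)
    (hWd : Cd • W.quadraticTwist (NumberField.discr K : ℚ) = Wd)
    (hΔ : W.Δ < 0) (ht : transpCount W (NumberField.discr K) = 1) (hs : identCount W (NumberField.discr K) = 0)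
    (hodd : Odd Dt.c)
    (hSelW : Nat.card (W.selmerGroup 2) ≤ 2) (hSelD : Nat.card (Wd.selmerGroup 2) ≤ 1) :
    padicValNat 2 (Nat.card (AddCommGroup.primaryComponent W.sha 2)) +
        padicValNat 2 (Nat.card (AddCommGroup.primaryComponent Wd.sha 2)) +
        transpCount W (NumberField.discr K) + 2 * identCount W (NumberField.discr K) + 2 * padicValInt 2 Dt.c ≤
      2 * 0 + (if W.Δ < 0 then 1 else 0) :=
  bottom_inequality_of_card_selmerGroup_le_at hnf W hT hr hrQ K hK hGZ hKo hadm hLt Dt H ι P hP Wd Cd hWd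
    ((minimal_iff_of_neg W _ hΔ).mpr ⟨ht, hs⟩) hodd hSelW hSelD

/-! ### §4 The two tree statements from their `2`-Selmer forms, modulo the four primary printed facts -/

/-- **U₀ `DoorIndexLawUpperCAtTwoBottom` from its `2`-SELMER FORM**, modulo the four primary printed facts of `S_pub4` (Gross–Zagier,
Kolyvagin, modularity as a newform, Hoffstein–Luo — the last three only to put `rank W(ℚ) = 1` on the slice,
`mordellWeilRank_eq_one_of_analyticRank_eq_one_of_isGloballyMinimal`).  The hypothesis `hSel` has the binders of
`DoorIndexLawUpperCAtTwoBottom` VERBATIM and concludes `#Sel₂(W/ℚ) ≤ 2 ∧ #Sel₂(Wd/ℚ) ≤ 1` — the output of Kolyvagin's first `2`-descent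
over `ℚ` (`card_sel_eq_two` / `twinSel_eq_bot`).  Conditional by design; BSD is not proved by this. [cite: GrossLMS1991, Prop. 2.3 and §10]
[cite: Kolyvagin1990, Thm. A] -/
theorem doorIndexLawUpperCAtTwoBottom_of_selmerTwo
    (hGZ : ∀ (N : ℕ) [NeZero N] (W : WeierstrassCurve ℚ) (K : Type) [Field K] [NumberField K], gross_zagier N W K)
    (hKo : ∀ (N : ℕ) [NeZero N] (W : WeierstrassCurve ℚ) (K : Type) [Field K] [NumberField K], kolyvagin N W K)
    (hnf : exists_isNewformOf) (hHL : HoffsteinLuo1997_exists_twist_L_one_ne_zero)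
    (hSel : ∀ (W : WeierstrassCurve ℚ) [W.IsElliptic] [W.IsGloballyMinimal] [NeZero (W.conductorNorm ℤ)],
      ¬ W.HasCM → (∀ n : ℕ, W.HasSurjectiveModNGaloisRep ((2 ^ n : ℕ) : ℤ)) → Odd W.torsionOrder → Odd W.tamagawaProduct →
      W.analyticRank = 1 →
      ∀ (K : Type) [Field K] [NumberField K], IsImaginaryQuadratic K →
        DoorAdmissible W (NumberField.discr K) →
        (W.quadraticTwist (NumberField.discr K : ℚ)).entireLFunction 1 ≠ 0 →
        ∀ (Dt : ModularParametrizationData W (W.conductorNorm ℤ))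
          (H : HeegnerDatum (W.conductorNorm ℤ) (NumberField.discr K)) (ι : K →+* ℂ)
          (P : (W.baseChange K).toAffine.Point),
          WeierstrassCurve.Affine.Point.map ι.toRatAlgHom P = heegnerPointComplex Dt H →
          ∀ (Wd : WeierstrassCurve ℚ) [Wd.IsElliptic] [Wd.IsGloballyMinimal] (Cd : WeierstrassCurve.VariableChange ℚ),
            Cd • W.quadraticTwist (NumberField.discr K : ℚ) = Wd →
            transpCount W (NumberField.discr K) + 2 * identCount W (NumberField.discr K) = (if W.Δ < 0 then 1 else 0) →
            Odd Dt.c → HasTwoDivisibilityUpToTorsion W K P 0 →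
              Nat.card (W.selmerGroup 2) ≤ 2 ∧ Nat.card (Wd.selmerGroup 2) ≤ 1) :
    DoorIndexLawUpperCAtTwoBottom := by
  intro W _ _ _ hCM hsurj hT hc hr K _ _ hK hadm hLt Dt H ι P hP Wd _ _ Cd hWd hmin hodd hm
  have hrQ : W.mordellWeilRank = 1 := (mordellWeilRank_eq_one_of_analyticRank_eq_one_of_isGloballyMinimal hGZ hKo hnf hHL W hr).1
  obtain ⟨hSelW, hSelD⟩ := hSel W hCM hsurj hT hc hr K hK hadm hLt Dt H ι P hP Wd Cd hWd hmin hodd hm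
  exact bottom_inequality_of_card_selmerGroup_le_at hnf W hT hr hrQ K hK (hGZ _ W K) (hKo _ W K) hadm hLt Dt H ι P hP Wd Cd hWd
    hmin hodd hSelW hSelD

/-- **U₀⁻ `DoorIndexLawUpperCAtTwoBottomNeg` from its `2`-SELMER FORM**, modulo the four primary printed facts of `S_pub4`; the
hypothesis `hSel` has the binders of `DoorIndexLawUpperCAtTwoBottomNeg` VERBATIM and concludes `#Sel₂(W/ℚ) ≤ 2 ∧ #Sel₂(Wd/ℚ) ≤ 1`.
So the registered stub `stub_doorUpperBottomNeg : S_pub4 → DoorIndexLawUpperCAtTwoBottomNeg` (skeleton v8.7) IS, granted `S_pub4`, the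
`2`-Selmer statement — the exact output currency of `…OneDoorFirstDescentAtTwo.lean`.  Conditional by design; BSD is not proved by this.
[cite: GrossLMS1991, Prop. 2.3 and §10] [cite: Kolyvagin1990, Thm. A] -/
theorem doorIndexLawUpperCAtTwoBottomNeg_of_selmerTwo
    (hGZ : ∀ (N : ℕ) [NeZero N] (W : WeierstrassCurve ℚ) (K : Type) [Field K] [NumberField K], gross_zagier N W K)
    (hKo : ∀ (N : ℕ) [NeZero N] (W : WeierstrassCurve ℚ) (K : Type) [Field K] [NumberField K], kolyvagin N W K)
    (hnf : exists_isNewformOf) (hHL : HoffsteinLuo1997_exists_twist_L_one_ne_zero)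
    (hSel : ∀ (W : WeierstrassCurve ℚ) [W.IsElliptic] [W.IsGloballyMinimal] [NeZero (W.conductorNorm ℤ)],
      ¬ W.HasCM → (∀ n : ℕ, W.HasSurjectiveModNGaloisRep ((2 ^ n : ℕ) : ℤ)) → Odd W.torsionOrder → Odd W.tamagawaProduct →
      W.analyticRank = 1 →
      ∀ (K : Type) [Field K] [NumberField K], IsImaginaryQuadratic K →
        DoorAdmissible W (NumberField.discr K) →
        (W.quadraticTwist (NumberField.discr K : ℚ)).entireLFunction 1 ≠ 0 →
        ∀ (Dt : ModularParametrizationData W (W.conductorNorm ℤ))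
          (H : HeegnerDatum (W.conductorNorm ℤ) (NumberField.discr K)) (ι : K →+* ℂ)
          (P : (W.baseChange K).toAffine.Point),
          WeierstrassCurve.Affine.Point.map ι.toRatAlgHom P = heegnerPointComplex Dt H →
          ∀ (Wd : WeierstrassCurve ℚ) [Wd.IsElliptic] [Wd.IsGloballyMinimal] (Cd : WeierstrassCurve.VariableChange ℚ),
            Cd • W.quadraticTwist (NumberField.discr K : ℚ) = Wd →
            W.Δ < 0 → transpCount W (NumberField.discr K) = 1 → identCount W (NumberField.discr K) = 0 → Odd Dt.c →
            HasTwoDivisibilityUpToTorsion W K P 0 →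
              Nat.card (W.selmerGroup 2) ≤ 2 ∧ Nat.card (Wd.selmerGroup 2) ≤ 1) :
    DoorIndexLawUpperCAtTwoBottomNeg := by
  intro W _ _ _ hCM hsurj hT hc hr K _ _ hK hadm hLt Dt H ι P hP Wd _ _ Cd hWd hΔ ht hs hodd hm
  have hrQ : W.mordellWeilRank = 1 := (mordellWeilRank_eq_one_of_analyticRank_eq_one_of_isGloballyMinimal hGZ hKo hnf hHL W hr).1
  obtain ⟨hSelW, hSelD⟩ := hSel W hCM hsurj hT hc hr K hK hadm hLt Dt H ι P hP Wd Cd hWd hΔ ht hs hodd hm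
  exact bottomNeg_inequality_of_card_selmerGroup_le_at hnf W hT hr hrQ K hK (hGZ _ W K) (hKo _ W K) hadm hLt Dt H ι P hP Wd Cd hWd
    hΔ ht hs hodd hSelW hSelD

end Summit.BirchSwinnertonDyer.BirchSwinnertonDyer.Theorems.RankOneAtTwoOneDoor

end
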